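import Summits.Ventures.PercRepro.C041ConeClassF

/-!
# ROW C-041 — A CYCLE WITH ONE HANGING ZONE IS IN THE CONE WHENEVER THE ZONE IS (p6, gen 31; mine-3's apex lemma in
cone form `InCone_thetaTri_one`, C041TriangleMixedFamily, through the cycle dictionary)

The cycle `C_{n+1}` through the anchor with a zone `Z` hung at `x_i` (and the trivial zone — one unmarked vertex —
at a second exit `x_j`, which changes nothing) is `cyc2 n i j Z a (pointZone 0 0) ()`; its six-vector is
`thetaCyc (2^ℓ₁ − 2) (2^ℓ₂ − 2) (2^ℓ₃ − 2) (Π Z) 1`, and mine-3's `InCone_thetaTri_one` (the triangle with a cone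
member and an unmarked vertex is in the cone) with `InCone_thetaCyc_of_InCone_tri` gives: **every cycle through the
anchor with one cone zone hung anywhere is in the cone** (`inCone_sixVec_cyc2_one`; the mirror position
`inCone_sixVec_cyc2_one'`), hence satisfies the ZONE O-CUBE; in particular for every member of the class `IsZf`
(`IsZf.inCone_cyc2_one`).
-/

namespace PercRepro

namespace ZoneZ

namespace TwoExit

open ZoneData TreeClosure RelaxedTriangle PointZone Finset

variable (n : ℕ) (i j : Fin (n + 1))
variable {V E T₁ T₂ : Type} (Z : ZoneData V E T₁ T₂) (a : V)
variable [Fintype E] [DecidableEq E] [Fintype T₁] [DecidableEq T₁] [Fintype T₂] [DecidableEq T₂]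

/-- **The cycle with one cone zone (at the first exit) is in the cone.** -/
theorem inCone_sixVec_cyc2_one (hi : 0 < i.val) (hij : i.val < j.val) (h : InCone (Z.sixVec a)) :
    InCone ((cyc2 n i j Z a (pointZone 0 0) ()).sixVec (Sum.inl (Sum.inl 0))) := by
  obtain ⟨h₁, h₂, h₃⟩ := arc_lengths n i j hi hij
  rw [sixVec_cyc2 n i j _ _ _ _ hi hij, sixVec_pointZone, pow_zero, pow_zero, mul_one, mul_one]
  exact InCone_thetaCyc_of_InCone_tri h InCone_one (InCone_thetaTri_one h) (mixed_mult_nonneg _ h₁)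
    (mixed_mult_nonneg _ h₂) (mixed_mult_nonneg _ h₃)

/-- **The cycle with one cone zone (at the second exit) is in the cone.** -/
theorem inCone_sixVec_cyc2_one' (hi : 0 < i.val) (hij : i.val < j.val) (h : InCone (Z.sixVec a)) :
    InCone ((cyc2 n i j (pointZone 0 0) () Z a).sixVec (Sum.inl (Sum.inl 0))) := by
  obtain ⟨h₁, h₂, h₃⟩ := arc_lengths n i j hi hij
  rw [sixVec_cyc2 n i j _ _ _ _ hi hij, sixVec_pointZone, pow_zero, pow_zero, mul_one, mul_one]
  refine InCone_thetaCyc_of_InCone_tri InCone_one h ?_ (mixed_mult_nonneg _ h₁) (mixed_mult_nonneg _ h₂)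
    (mixed_mult_nonneg _ h₃)
  rw [thetaTri_comm]
  exact InCone_thetaTri_one h

/-- **The ZONE O-CUBE on every cycle with one cone zone.** -/
theorem zoneOCubeConj_cyc2_one (hi : 0 < i.val) (hij : i.val < j.val) (h : InCone (Z.sixVec a)) :
    (cyc2 n i j Z a (pointZone 0 0) ()).ZoneOCubeConj {Sum.inl (Sum.inl 0)}
      (∅ : Set ((Fin (n + 1) ⊕ Unit) ⊕ V)) :=
  (cyc2 n i j Z a (pointZone 0 0) ()).zoneOCubeConj_of_inCone_sixVec _ (inCone_sixVec_cyc2_one n i j Z a hi hij h)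

/-- The ZONE O-CUBE on every cycle with one cone zone, mirror position. -/
theorem zoneOCubeConj_cyc2_one' (hi : 0 < i.val) (hij : i.val < j.val) (h : InCone (Z.sixVec a)) :
    (cyc2 n i j (pointZone 0 0) () Z a).ZoneOCubeConj {Sum.inl (Sum.inl 0)}
      (∅ : Set ((Fin (n + 1) ⊕ V) ⊕ Unit)) :=
  (cyc2 n i j (pointZone 0 0) () Z a).zoneOCubeConj_of_inCone_sixVec _ (inCone_sixVec_cyc2_one' n i j Z a hi hij h)


/-! ## Conditional on the pure triangle conjecture -/

/-- **The cone conjecture for every two-exit cycle of the graph model reduces to mine-3's PURE triangle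
conjecture** (`InCone_thetaTri_of_pure`, C-041.md §21 (d)): if `θ_△(V a, V b)` lies in the cone for all pure roots,
then every cycle through the anchor with two cone zones hung at any two vertices is in the cone. -/
theorem inCone_sixVec_cyc2_of_pure
    (H : ∀ {m m' : ℕ} (a : Fin m → ℝ) (b : Fin m' → ℝ), (∀ i, 0 ≤ a i ∧ a i ≤ 1) → (∀ j, 0 ≤ b j ∧ b j ≤ 1) →
      InCone (thetaTri (TreeClosure.V a) (TreeClosure.V b)))
    {V' E' T₁' T₂' : Type} (Z' : ZoneData V' E' T₁' T₂') (a' : V') [Fintype E'] [DecidableEq E'] [Fintype T₁']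
    [DecidableEq T₁'] [Fintype T₂'] [DecidableEq T₂'] (hi : 0 < i.val) (hij : i.val < j.val)
    (h : InCone (Z.sixVec a)) (h' : InCone (Z'.sixVec a')) :
    InCone ((cyc2 n i j Z a Z' a').sixVec (Sum.inl (Sum.inl 0))) := by
  obtain ⟨h₁, h₂, h₃⟩ := arc_lengths n i j hi hij
  rw [sixVec_cyc2 n i j Z a Z' a' hi hij]
  exact InCone_thetaCyc_of_InCone_tri h h' (InCone_thetaTri_of_pure H h h') (mixed_mult_nonneg _ h₁)
    (mixed_mult_nonneg _ h₂) (mixed_mult_nonneg _ h₃)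

end TwoExit

open TreeClosure in
/-- **Every cycle through the anchor with one member of `IsZf` hung anywhere is in the cone.** -/
theorem IsZf.inCone_cyc2_one (n : ℕ) (i j : Fin (n + 1)) (hi : 0 < i.val) (hij : i.val < j.val)
    {V E T₁ T₂ : Type} (Z : ZoneData V E T₁ T₂) (a : V) [Fintype E] [DecidableEq E] [Fintype T₁] [DecidableEq T₁]
    [Fintype T₂] [DecidableEq T₂] (h : IsZf Z a) :
    InCone ((TwoExit.cyc2 n i j Z a (PointZone.pointZone 0 0) ()).sixVec (Sum.inl (Sum.inl 0))) :=
  TwoExit.inCone_sixVec_cyc2_one n i j Z a hi hij (h.inCone _ _ _ _ _ _)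

/-- The ZONE O-CUBE on every cycle with one member of `IsZf`. -/
theorem IsZf.zoneOCubeConj_cyc2_one (n : ℕ) (i j : Fin (n + 1)) (hi : 0 < i.val) (hij : i.val < j.val)
    {V E T₁ T₂ : Type} (Z : ZoneData V E T₁ T₂) (a : V) [Fintype E] [DecidableEq E] [Fintype T₁] [DecidableEq T₁]
    [Fintype T₂] [DecidableEq T₂] (h : IsZf Z a) :
    (TwoExit.cyc2 n i j Z a (PointZone.pointZone 0 0) ()).ZoneOCubeConj {Sum.inl (Sum.inl 0)}
      (∅ : Set ((Fin (n + 1) ⊕ Unit) ⊕ V)) :=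
  TwoExit.zoneOCubeConj_cyc2_one n i j Z a hi hij (h.inCone _ _ _ _ _ _)

end ZoneZ

end PercRepro
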